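import Summits.Ventures.PercRepro.MSTightConjTSecondDirection

/-!
# Conjecture (T) from an addable element avoided by the partnerless `r`-members

Dossier proofs/MINE1-theoremS.md, Addendum 47 (supplement 1). No second tightening direction is
needed: the tight twin-free trace `P = proj r F` is closed under adding every element of its
addable part `R*(P)` and under removing every other element (Theorem S, `dichotomy_of_tight`).
* If some **addable** `e` lies in no partnerless `r`-member, then for a partnerless `t` the member
  `t ∪ e` of the trace is not partnerless, hence `r`-free, and contains `t ⊇ z = t ∖ s`; the
  realisation lemma puts `z` into `X` (`diffsY_subset_diffsX_of_addable_avoids`).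
* If some **removable** `e` lies in every partnerless `r`-free member, then for a partnerless `s`
  the member `s ∖ e` is an `r`-member disjoint from `z` (`diffsY_subset_diffsX_of_removable_mem`).

The candidate Prop `AddableAvoids α` (never asserted) records the census: on every case-(β) residue
configuration with `|P₀|, |P₁| ≥ 2` BOTH clauses hold (1,140 / 1,140; the remaining configurations
are singleton sides, covered by MSTightConjTSingleton). It implies `GoodDirection α`-style closure
of the lane: `singNonMonotone_of_addableAvoids_of_residue`.
-/

namespace PercRepro.MSTight

open Finset
open scoped FinsetFamily

variable {α : Type*} [DecidableEq α] [Fintype α] {r e : α} {F : Finset (Finset α)}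

section Argument

variable (hP : Tight (proj r F)) (htf : ∀ a b, Twin (proj r F) a b → a = b)
include hP htf

/-- **An addable element avoided by every partnerless `r`-member gives `Y ⊆ X`.** -/
theorem diffsY_subset_diffsX_of_addable_avoids (he : ClosedAdd (proj r F) {e})
    (hE : ∀ t ∈ partr r F, t ∉ part0 r F → e ∉ t) : diffsY r F ⊆ diffsX r F := by
  intro z hz
  obtain ⟨t, ht, s, hs, rfl⟩ := mem_diffs.1 hz
  by_cases ht0 : t ∈ part0 r F
  · exact mem_union_left _ (mem_union_left _ (mem_diffs.2 ⟨t, ht0, s, hs, rfl⟩))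
  · have htP : t ∈ proj r F := by rw [proj_eq_union]; exact mem_union_right _ ht
    have h1 : t ∪ {e} ∈ proj r F := he t htP
    have hzt : t \ s ⊆ t ∪ {e} := sdiff_subset.trans subset_union_left
    by_cases h0 : t ∪ {e} ∈ part0 r F
    · exact sdiff_mem_diffsX_of_superset_mem_part0 hP htf hz h0 hzt
    · rw [proj_eq_union] at h1
      rcases mem_union.1 h1 with h0' | h1'
      · exact absurd h0' h0
      · exact absurd (mem_union_right _ (mem_singleton_self e)) (hE _ h1' h0)

/-- **A removable element inside every partnerless `r`-free member gives `Y ⊆ X`.** -/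
theorem diffsY_subset_diffsX_of_removable_mem (he : ClosedRem (proj r F) {e})
    (hE : ∀ s ∈ part0 r F, s ∉ partr r F → e ∈ s) : diffsY r F ⊆ diffsX r F := by
  intro z hz
  obtain ⟨t, ht, s, hs, rfl⟩ := mem_diffs.1 hz
  by_cases hs1 : s ∈ partr r F
  · exact mem_union_left _ (mem_union_right _ (mem_diffs.2 ⟨t, ht, s, hs1, rfl⟩))
  · have hsP : s ∈ proj r F := by rw [proj_eq_union]; exact mem_union_left _ hs
    have h1 : s \ {e} ∈ proj r F := he s hsP
    have hdisj : Disjoint (t \ s) (s \ {e}) := sdiff_disjoint.mono_right sdiff_subset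
    by_cases h1' : s \ {e} ∈ partr r F
    · exact sdiff_mem_diffsX_of_disjoint_mem_partr hP htf hz h1' hdisj
    · rw [proj_eq_union] at h1
      rcases mem_union.1 h1 with h0 | h1''
      · exact absurd (hE _ h0 h1') (fun h => (mem_sdiff.1 h).2 (mem_singleton_self e))
      · exact absurd h1'' h1'

/-- On a tight twin-free trace every element is addable or removable (Theorem S); an element of
`R*(P)` avoided by all partnerless `r`-members, or an element outside `R*(P)` inside all partnerless
`r`-free members, gives `Y ⊆ X`. -/
theorem diffsY_subset_diffsX_of_Rstar_clause
    (h : (∃ e ∈ Rstar (proj r F), ∀ t ∈ partr r F, t ∉ part0 r F → e ∉ t) ∨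
      (∃ e ∉ Rstar (proj r F), ∀ s ∈ part0 r F, s ∉ partr r F → e ∈ s)) :
    diffsY r F ⊆ diffsX r F := by
  rcases h with ⟨e, he, hE⟩ | ⟨e, he, hE⟩
  · have hcls : cls (proj r F) e = {e} := cls_eq_singleton (fun x hx => (htf e x hx).symm)
    have hadd : ClosedAdd (proj r F) {e} := by rw [← hcls]; exact mem_Rstar.1 he
    exact diffsY_subset_diffsX_of_addable_avoids hP htf hadd hE
  · have hcls : cls (proj r F) e = {e} := cls_eq_singleton (fun x hx => (htf e x hx).symm)
    have hrem : ClosedRem (proj r F) {e} := by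
      rw [← hcls]; exact closedRem_of_notMem_Rstar (dichotomy_of_tight hP) he
    exact diffsY_subset_diffsX_of_removable_mem hP htf hrem hE

end Argument

section Candidate

variable (α)

/-- **The addable-avoids lemma, as a candidate Prop** (never asserted; Addendum 47 suppl. 1): in a
residue instance at a genuine tight trace with at least two partnerless members on each side, some
element of `R*(P)` lies in no partnerless `r`-member, or some element outside `R*(P)` lies in every
partnerless `r`-free member. Census: both clauses hold on all 1,140 case-(β) residue configurations
with `|P₀|, |P₁| ≥ 2`; the clause fails only on singleton sides (MSTightConjTSingleton). -/
def AddableAvoids : Prop :=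
  ∀ (F : Finset (Finset α)) (u : Finset α) (r : α), Residue F u → Tight (proj r F) →
    ({r} : Finset α) ∉ F → univ.erase r ∉ F →
    (∃ s ∈ part0 r F, s ∉ partr r F ∧ ∃ s' ∈ part0 r F, s' ∉ partr r F ∧ s ≠ s') →
    (∃ t ∈ partr r F, t ∉ part0 r F ∧ ∃ t' ∈ partr r F, t' ∉ part0 r F ∧ t ≠ t') →
    (∃ e ∈ Rstar (proj r F), ∀ t ∈ partr r F, t ∉ part0 r F → e ∉ t) ∨
      (∃ e ∉ Rstar (proj r F), ∀ s ∈ part0 r F, s ∉ partr r F → e ∈ s)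

variable {α}

/-- **`Y ⊆ X` in a residue instance at a genuine tight trace, from `AddableAvoids α`**: singleton
sides by MSTightConjTSingleton, both sides of size `≥ 2` by the addable / removable element. -/
theorem diffsY_subset_diffsX_of_addableAvoids (hAA : AddableAvoids α) {u : Finset α}
    (h : Residue F u) (hP : Tight (proj r F)) (hr1 : ({r} : Finset α) ∉ F)
    (hr2 : univ.erase r ∉ F) : diffsY r F ⊆ diffsX r F := by
  have htfP : ∀ a b, Twin (proj r F) a b → a = b := twinFree_proj_of_twinFree h.htf h.hsupp
  by_cases hs2 : ∃ s ∈ part0 r F, s ∉ partr r F ∧ ∃ s' ∈ part0 r F, s' ∉ partr r F ∧ s ≠ s'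
  · by_cases ht2 : ∃ t ∈ partr r F, t ∉ part0 r F ∧ ∃ t' ∈ partr r F, t' ∉ part0 r F ∧ t ≠ t'
    · exact diffsY_subset_diffsX_of_Rstar_clause hP htfP (hAA F u r h hP hr1 hr2 hs2 ht2)
    · apply diffsY_subset_diffsX_of_partr_subsingleton hP htfP
      · intro a
        obtain ⟨t, htF, hat⟩ := h.hcore a
        exact ⟨t.erase r, mem_proj.2 ⟨t, htF, rfl⟩, fun h' => hat (mem_erase.1 h').2⟩
      · exact empty_notMem_proj_of_genuine h.hempty hr1
      · intro t ht ht0 t' ht' ht0'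
        by_contra hne
        exact ht2 ⟨t, ht, ht0, t', ht', ht0', hne⟩
  · apply diffsY_subset_diffsX_of_part0_subsingleton hP htfP
    · intro a har
      obtain ⟨t, htF, hat⟩ := h.hsupp a
      exact ⟨t.erase r, mem_proj.2 ⟨t, htF, rfl⟩, mem_erase.2 ⟨har, hat⟩⟩
    · exact univ_erase_notMem_proj_of_genuine h.huniv hr2
    · intro s hs0 hs1 s' hs0' hs1'
      by_contra hne
      exact hs2 ⟨s, hs0, hs1, s', hs0', hs1', hne⟩

/-- **`SingNonMonotone α` from `AddableAvoids α` and `SingCaseIResidue α`.** -/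
theorem singNonMonotone_of_addableAvoids_of_residue (hAA : AddableAvoids α)
    (hR : SingCaseIResidue α) : SingNonMonotone α := by
  intro F u r h hP hru hu1 hrem hadd
  by_contra hcon
  push Not at hcon
  obtain ⟨hr1, hr2⟩ := hcon
  have hT : diffsY r F ⊆ diffsX r F := diffsY_subset_diffsX_of_addableAvoids hAA h hP hr1 hr2
  obtain ⟨s, hs, hsY⟩ :=
    exists_part0_sdiff_notMem_diffsY_of_not_tight_insert h.hexc h.hu h.hnt hru hu1 hT
  exact hsY (hR F u r h hP hru hu1 hrem hadd hT hr1 hr2 s hs)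

end Candidate

end PercRepro.MSTight
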